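import Literature.Barriers.NavierStokesRegularity.CriticalNormBlowupNecessity
import Literature.Analysis.FluidPDE.NSEssEndpointProofs
import Literature.Analysis.FluidPDE.NSLerayHopfSereginProofs
import Literature.Analysis.FluidPDE.TaoBlowupRate
import Literature.Analysis.FluidPDE.TaoBlowupRateSerrin
import Literature.Analysis.FluidPDE.NSGaldiEnergyEqualityHolds
import Literature.Analysis.FluidPDE.NSSerrinRegularityTao
import Literature.Analysis.FluidPDE.TaoH1AlmostRegularAssembly
import Literature.Analysis.FluidPDE.TaoH1FourierLocalExistenceHolds
import Literature.Analysis.FluidPDE.MildL3Smooth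
import Literature.Analysis.FluidPDE.KatoLocalL3Exists
import Literature.Analysis.FluidPDE.NSEssEndpointLocalHolder
import Literature.Analysis.FluidPDE.NSLerayHopfSereginESS
import Literature.Analysis.FluidPDE.NSLerayBlowupRateTopHolds
import Literature.Analysis.FluidPDE.TaoBlowupRateOfQuantitative
import Literature.Analysis.FluidPDE.NSEssSupBoundNoConcentration
import Literature.Analysis.FluidPDE.NSLerayHopfSereginAssembly
import Literature.Analysis.FluidPDE.NSEssEndpointHolds
import Literature.Analysis.FluidPDE.MildL3SmoothHolds
import HarnessLib

/-!
# Barrier `CriticalNormBlowupNecessity`: reduction to the current leaves of its decomposition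

`Literature.Barriers.NavierStokesRegularity.CriticalNormBlowupNecessity` (this directory) is the
conjunction of three named facts of `Literature/Analysis/FluidPDE`:

* `ess_endpoint` — Escauriaza–Seregin–Šverák 2003, Thms. 1.3–1.4 (`NSLerayHopf.lean`);
* `seregin_L3_blowup` — Seregin 2012, Thm. 1.1 (`NSLerayHopf.lean`);
* `tao_L3_blowup_rate` — Tao 2021, Thm. 1.4 (`PartialRegularity.lean`).

Each conjunct is a deep theorem whose printed proof rests on theories the tree does not yet
prove (Caffarelli–Kohn–Nirenberg ε-regularity, Carleman inequalities / backward uniqueness for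
the heat operator, Kato's `L³` theory, Lemarié-Rieusset's local Leray solutions, Tao's
quantitative Carleman machinery). The tree decomposes them along the printed proofs:

* `ess_endpoint_of_ESS_theory` (`NSEssEndpointProofs.lean`): `ess_endpoint` from the six named
  facts `ess_local_holder` (ESS Thm. 1.4), `ess_epsilon_regularity'` (ESS Lemma 2.2),
  `ess_associated_pressure` (ESS (3.2)–(3.4)), `ess_kato_L3_local` (ESS Thm. 7.4),
  `galdi_energy_equality` (Galdi 2019, Thm. 1.1), `ladyzhenskaya_prodi_serrin` (ESS Thm. 1.2);
* `seregin_L3_blowup_of_facts` (`NSLerayHopfSereginProofs.lean`): `seregin_L3_blowup` from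
  `seregin_L3_blowup_mild` (Lemarié-Rieusset 2016, Thm. 15.5 = Seregin 2012, Thm. 1.1 for mild
  `C_t L³` solutions) and `mild_L3_smooth` (Giga 1986, Thm. 4), the other inputs
  (`kato_unique`, `isMildNSSolutionOn_of_isLerayHopfOn`) being proved;
* `tao_L3_blowup_rate_of_quantitative_of_bkm` (`TaoBlowupRate.lean`): `tao_L3_blowup_rate` from
  `tao_quantitative_ess` (Tao 2021, Thm. 1.2) and `beale_kato_majda` (Beale–Kato–Majda 1984,
  Thm. 1), following Tao's printed proof (§6);
* `tao_L3_blowup_rate_of_quantitative_of_localExistence` (`TaoBlowupRateSerrin.lean`): the same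
  conjunct from `tao_quantitative_ess` and Tao's local existence theorem
  `tao2011_smooth_local_existence` (Tao 2013, Thm. 5.4 (ii)+(iv)) — the other alternative named
  in Tao's printed proof, the Prodi–Serrin–Ladyzhenskaya criterion at the endpoint `L²_t L^∞_x`,
  proved there in Tao's class from the local existence theorem, Serrin's enstrophy inequality and
  uniqueness in the Sobolev class.

This file records the resulting **dependency-tracker forms of the barrier**:

* `criticalNormBlowupNecessity_of_leaves`: the ten leaves of the first decomposition (with
  `beale_kato_majda`) imply `CriticalNormBlowupNecessity`;
* `criticalNormBlowupNecessity_of_leaves'`: the same with `beale_kato_majda` replaced by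
  `tao2011_smooth_local_existence`;
* `criticalNormBlowupNecessity_of_leaves₈`: the **eight current leaves** — since
  `galdi_energy_equality` is proved (`galdi_energy_equality_holds`,
  `NSGaldiEnergyEqualityHolds.lean`), and both `ladyzhenskaya_prodi_serrin`
  (`ladyzhenskaya_prodi_serrin_of_tao`, `NSSerrinRegularityTao.lean`, with
  `tao2011_H1_local_almost_regular_of_smooth_local_existence`, `TaoH1AlmostRegularAssembly.lean`)
  and `tao2011_smooth_local_existence` (`tao2011_smooth_local_existence_of_fourier` with the proved
  `tao2011_fourier_local_existence_holds`, `TaoH1FourierLocalExistenceHolds.lean`) follow from the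
  Plancherel fact `sobolev_fourierDatum_of_smooth` (`TaoH1FourierDecomposition.lean`), and since
  `mild_L3_smooth` follows from `classical_of_bounded_mild_L3` (`mild_L3_smooth_of_interior_bounded`,
  `MildL3Smooth.lean`, with the proved `mild_L3_interior_bounded_holds`, `KatoLocalL3Exists.lean`),
  the barrier is implied by `ess_local_holder`, `ess_epsilon_regularity'`, `ess_associated_pressure`,
  `ess_kato_L3_local` (ESS 2003), `seregin_L3_blowup_mild` (Seregin 2012 via Lemarié-Rieusset 2016,
  Thm. 15.5), `classical_of_bounded_mild_L3` (Lemarié-Rieusset 2016, Thm. 9.12; Giga 1986),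
  `tao_quantitative_ess` (Tao 2021, Thm. 1.2) and `sobolev_fourierDatum_of_smooth` (Plancherel for
  smooth `H^∞` fields);
* `criticalNormBlowupNecessity_of_leaves₃`: the **three current leaves, one per cited paper** —
  since `ess_associated_pressure`, `ess_kato_L3_local`, `sobolev_fourierDatum_of_smooth`,
  `lemarieRieusset_epsilon_regularity` (= ESS Lemma 2.2 in Lemarié-Rieusset's form),
  `tao2011_smooth_local_existence` and `leray_blowup_rate_top` are now theorems of the tree
  (`ess_associated_pressure_holds`, `ess_kato_L3_local_holds`,
  `sobolev_fourierDatum_of_smooth_holds`, `lemarieRieusset_epsilon_regularity_holds`,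
  `tao2011_smooth_local_existence_holds`, `leray_blowup_rate_top_holds`), the accepted reductions
  `ess_endpoint_of_local_holder` and `ess_sup_bound_of_local_holder`
  (`NSEssEndpointLocalHolder.lean`, `NSEssEndpointReduced.lean`), `seregin_L3_blowup_of_ess`
  (`NSLerayHopfSereginESS.lean`: Seregin's criterion from Thm. 15.5, ESS (3.5)–(3.6) and Leray's
  lower blow-up rate, without Kato smoothing) and `tao_L3_blowup_rate_of_quantitative`
  (`TaoBlowupRateOfQuantitative.lean`) leave exactly `ess_local_holder` (Escauriaza–Seregin–Šverák
  2003, Thm. 1.4), `seregin_L3_blowup_mild` (Seregin 2012, Thm. 1.1 for mild `C_t L³` solutions =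
  Lemarié-Rieusset 2016, Thm. 15.5) and `tao_quantitative_ess` (Tao 2021, Thm. 1.2);
* `criticalNormBlowupNecessity_of_noConcentration` and
  `criticalNormBlowupNecessity_of_noConcentration_of_liminf_L3`: the **current frontier below
  those leaves**. On the ESS side the accepted `ess_endpoint_of_noConcentration`
  (`NSEssSupBoundNoConcentration.lean`) derives `ess_endpoint` from the single statement (NC)
  "no point of `Q̄(1/2)` is a point of `ε`-concentration of `|v|³ + |p|^{3/2}` for a pair with
  ESS (1.15)–(1.16) on `Q(1)`" — the content of the blow-up / backward-uniqueness /
  unique-continuation argument of ESS §3, (3.8)–(3.35) — WITHOUT the Hölder form of Lemma 2.2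
  that `ess_local_holder` itself still requires (`ess_local_holder_of_epsilonRegularity_of_noConcentration`,
  `ESSLocalHolderCovering.lean`); (NC) is not a named fact of the tree, so it is carried here
  verbatim as the hypothesis `hno`. On the Seregin side `seregin_L3_blowup_of_seregin_mild`
  (`MildL3SmoothHolds.lean`, Thm. 15.13 with `mild_L3_smooth_holds`) needs Thm. 15.5 alone, and
  Thm. 15.5 follows from the core fact `seregin_regular_of_liminf_L3` (an `L³` bound along
  `t_k ↑ T` makes every `(T, x₀)` regular; Lemarié-Rieusset 2016, proof of Thm. 15.5,
  pp. 570–573) now that Thm. 15.1 (C) is proved (`seregin_L3_blowup_mild_of_liminf_L3`,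
  `NSLerayHopfSereginAssembly.lean`, with `lemarieRieusset_singular_point_of_blowup_holds`). So the
  barrier follows from (NC), `seregin_L3_blowup_mild` (or `seregin_regular_of_liminf_L3`) and
  `tao_quantitative_ess`.

When the leaves are discharged (`*_holds`), `CriticalNormBlowupNecessity_holds` is one of these
theorems applied to them; until then the barrier is conditional on exactly these named facts.

## References

* L. Escauriaza, G. Seregin, V. Šverák, Russ. Math. Surveys 58:2 (2003), 211–250, Thms. 1.2–1.4,
  Lemma 2.2, (3.2)–(3.6), Thm. 7.4.
* G. Seregin, Comm. Math. Phys. 312 (2012), 833–845, Thm. 1.1; P. G. Lemarié-Rieusset, *The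
  Navier–Stokes problem in the 21st century* (2016), Thm. 15.5.
* T. Tao, arXiv:1908.04958v2 = Proc. Sympos. Pure Math. 104 (2021), Thms. 1.2, 1.4, §6.
* J. T. Beale, T. Kato, A. Majda, Comm. Math. Phys. 94 (1984), Thm. 1.
* T. Tao, Anal. PDE 6 (2013), 25–107 = arXiv:1108.1165, Thm. 5.4 (ii)+(iv).
* E. M. Stein, G. Weiss, *Introduction to Fourier Analysis on Euclidean Spaces* (1971), Ch. I,
  Thms. 1.8, 2.3 (the Plancherel leaf `sobolev_fourierDatum_of_smooth`).
* P. G. Lemarié-Rieusset (2016), Thm. 9.12 (bounded mild solutions are smooth; the leaf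
  `classical_of_bounded_mild_L3`); T. Kato, Math. Z. 187 (1984), Thm. 1 (proved in tree,
  `kato_local_L3_holds`, `mild_L3_interior_bounded_holds`).
-/

noncomputable section

namespace Literature.Barriers.NavierStokesRegularity

open Literature.Analysis.FluidPDE
open _root_.MeasureTheory

/-- **The barrier from the current leaves of the three decompositions.** The ten named facts
`ess_local_holder`, `ess_epsilon_regularity'`, `ess_associated_pressure`, `ess_kato_L3_local`,
`galdi_energy_equality`, `ladyzhenskaya_prodi_serrin` (for `ess_endpoint`, ESS 2003 Thm. 1.3),
`seregin_L3_blowup_mild`, `mild_L3_smooth` (for `seregin_L3_blowup`, Seregin 2012 Thm. 1.1) and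
`tao_quantitative_ess`, `beale_kato_majda` (for `tao_L3_blowup_rate`, Tao 2021 Thm. 1.4) imply
`CriticalNormBlowupNecessity`. Real proof (assembly of `ess_endpoint_of_ESS_theory`,
`seregin_L3_blowup_of_facts`, `tao_L3_blowup_rate_of_quantitative_of_bkm` and
`criticalNormBlowupNecessity_of`). [cite: EscauriazaSereginSverak2003, Thms. 1.3–1.4] -/
theorem criticalNormBlowupNecessity_of_leaves
    (hLH : ess_local_holder) (hε : ess_epsilon_regularity') (hP : ess_associated_pressure)
    (hK : ess_kato_L3_local) (hG : galdi_energy_equality) (hLPS : ladyzhenskaya_prodi_serrin)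
    (h15 : seregin_L3_blowup_mild) (hS : mild_L3_smooth)
    (h12 : tao_quantitative_ess) (hBKM : beale_kato_majda) :
    CriticalNormBlowupNecessity :=
  criticalNormBlowupNecessity_of (ess_endpoint_of_ESS_theory hLH hε hP hK hG hLPS)
    (seregin_L3_blowup_of_facts h15 hS) (tao_L3_blowup_rate_of_quantitative_of_bkm h12 hBKM)

/-- The same with the leaves conjoined per conjunct (the shape a dependency tracker reads: three
groups, one per conjunct of the barrier). [cite: EscauriazaSereginSverak2003, Thms. 1.3–1.4] -/
theorem criticalNormBlowupNecessity_of_and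
    (hESS : ess_local_holder ∧ ess_epsilon_regularity' ∧ ess_associated_pressure ∧
      ess_kato_L3_local ∧ galdi_energy_equality ∧ ladyzhenskaya_prodi_serrin)
    (hSer : seregin_L3_blowup_mild ∧ mild_L3_smooth)
    (hTao : tao_quantitative_ess ∧ beale_kato_majda) : CriticalNormBlowupNecessity :=
  criticalNormBlowupNecessity_of_leaves hESS.1 hESS.2.1 hESS.2.2.1 hESS.2.2.2.1 hESS.2.2.2.2.1
    hESS.2.2.2.2.2 hSer.1 hSer.2 hTao.1 hTao.2

/-- In particular the **Tao conjunct of the barrier is reduced to Thm. 1.2 and BKM**: given the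
other two conjuncts, `tao_quantitative_ess` and `beale_kato_majda` give the barrier.
[cite: Tao2021QuantitativeNS, §6, proof of Thm. 1.4] -/
theorem criticalNormBlowupNecessity_of_ess_of_seregin_of_quantitative
    (h₁ : ess_endpoint) (h₂ : seregin_L3_blowup) (h12 : tao_quantitative_ess)
    (hBKM : beale_kato_majda) : CriticalNormBlowupNecessity :=
  criticalNormBlowupNecessity_of h₁ h₂ (tao_L3_blowup_rate_of_quantitative_of_bkm h12 hBKM)

/-! ### Second form: Tao's local existence theorem in place of Beale–Kato–Majda -/

/-- **The barrier from the leaves, second form**: as `criticalNormBlowupNecessity_of_leaves`, but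
with the Tao conjunct `tao_L3_blowup_rate` obtained from `tao_quantitative_ess` (Tao 2021,
Thm. 1.2) and Tao's local existence theorem `tao2011_smooth_local_existence` (Tao 2013, Thm. 5.4
(ii)+(iv)) through the Prodi–Serrin–Ladyzhenskaya endpoint `L²_t L^∞_x`
(`tao_L3_blowup_rate_of_quantitative_of_localExistence`), instead of the Beale–Kato–Majda
criterion. Real proof. [cite: Tao2021QuantitativeNS, §6, proof of Thm. 1.4] -/
theorem criticalNormBlowupNecessity_of_leaves'
    (hLH : ess_local_holder) (hε : ess_epsilon_regularity') (hP : ess_associated_pressure)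
    (hK : ess_kato_L3_local) (hG : galdi_energy_equality) (hLPS : ladyzhenskaya_prodi_serrin)
    (h15 : seregin_L3_blowup_mild) (hS : mild_L3_smooth)
    (h12 : tao_quantitative_ess) (hE : tao2011_smooth_local_existence) :
    CriticalNormBlowupNecessity :=
  criticalNormBlowupNecessity_of (ess_endpoint_of_ESS_theory hLH hε hP hK hG hLPS)
    (seregin_L3_blowup_of_facts h15 hS) (tao_L3_blowup_rate_of_quantitative_of_localExistence h12 hE)

/-- In particular, given the other two conjuncts, `tao_quantitative_ess` and
`tao2011_smooth_local_existence` give the barrier. [cite: Tao2021QuantitativeNS, §6, proof of Thm. 1.4] -/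
theorem criticalNormBlowupNecessity_of_ess_of_seregin_of_quantitative_of_localExistence
    (h₁ : ess_endpoint) (h₂ : seregin_L3_blowup) (h12 : tao_quantitative_ess)
    (hE : tao2011_smooth_local_existence) : CriticalNormBlowupNecessity :=
  criticalNormBlowupNecessity_of h₁ h₂ (tao_L3_blowup_rate_of_quantitative_of_localExistence h12 hE)

/-! ### The eight current leaves -/

/-- **The barrier from its eight current leaves** (2026-08-15). `galdi_energy_equality` is proved
(`galdi_energy_equality_holds`); the Plancherel fact `sobolev_fourierDatum_of_smooth` gives Tao's
local existence theorem (`tao2011_smooth_local_existence_of_fourier` with the proved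
`tao2011_fourier_local_existence_holds`), hence `tao2011_H1_local_almost_regular`
(`tao2011_H1_local_almost_regular_of_smooth_local_existence`) and the Ladyzhenskaya–Prodi–Serrin
theorem (`ladyzhenskaya_prodi_serrin_of_tao`), and, with `tao_quantitative_ess`, the Tao conjunct
(`tao_L3_blowup_rate_of_quantitative_of_localExistence`); Kato's weighted `L³` theory is proved
(`mild_L3_interior_bounded_holds`), so `mild_L3_smooth` follows from `classical_of_bounded_mild_L3`
(`mild_L3_smooth_of_interior_bounded`). So `CriticalNormBlowupNecessity` follows from:
`ess_local_holder` (ESS 2003, Thm. 1.4), `ess_epsilon_regularity'` (ESS Lemma 2.2),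
`ess_associated_pressure` (ESS (3.2)–(3.4)), `ess_kato_L3_local` (ESS Thm. 7.4),
`seregin_L3_blowup_mild` (Lemarié-Rieusset 2016, Thm. 15.5), `classical_of_bounded_mild_L3`
(Lemarié-Rieusset 2016, Thm. 9.12; Giga 1986, Thm. 4, Remark), `tao_quantitative_ess` (Tao 2021,
Thm. 1.2) and `sobolev_fourierDatum_of_smooth` (Stein–Weiss 1971, Ch. I, Thms. 1.8, 2.3). Real
proof (assembly). [cite: EscauriazaSereginSverak2003, Thms. 1.3–1.4] -/
theorem criticalNormBlowupNecessity_of_leaves₈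
    (hLH : ess_local_holder) (hε : ess_epsilon_regularity') (hP : ess_associated_pressure)
    (hK : ess_kato_L3_local) (h15 : seregin_L3_blowup_mild) (hC : classical_of_bounded_mild_L3)
    (h12 : tao_quantitative_ess) (hPl : sobolev_fourierDatum_of_smooth) :
    CriticalNormBlowupNecessity :=
  have hE : tao2011_smooth_local_existence :=
    tao2011_smooth_local_existence_of_fourier tao2011_fourier_local_existence_holds hPl
  criticalNormBlowupNecessity_of_leaves' hLH hε hP hK galdi_energy_equality_holds
    (ladyzhenskaya_prodi_serrin_of_tao
      (tao2011_H1_local_almost_regular_of_smooth_local_existence hE))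
    h15 (mild_L3_smooth_of_interior_bounded mild_L3_interior_bounded_holds hC) h12 hE

/-- The eight leaves conjoined per conjunct of the barrier (four ESS leaves; two Seregin leaves;
Tao's Thm. 1.2 together with the shared Plancherel leaf). [cite: EscauriazaSereginSverak2003, Thms. 1.3–1.4] -/
theorem criticalNormBlowupNecessity_of_and₈
    (hESS : ess_local_holder ∧ ess_epsilon_regularity' ∧ ess_associated_pressure ∧
      ess_kato_L3_local)
    (hSer : seregin_L3_blowup_mild ∧ classical_of_bounded_mild_L3)
    (hTao : tao_quantitative_ess ∧ sobolev_fourierDatum_of_smooth) :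
    CriticalNormBlowupNecessity :=
  criticalNormBlowupNecessity_of_leaves₈ hESS.1 hESS.2.1 hESS.2.2.1 hESS.2.2.2 hSer.1 hSer.2
    hTao.1 hTao.2

/-! ### The three current leaves (one per cited paper) -/

/-- **The barrier from its three current leaves** (2026-08-15), one deep theorem per cited paper:
`ess_local_holder` (Escauriaza–Seregin–Šverák 2003, Thm. 1.4: local Hölder regularity of
`L_{3,∞}` suitable pairs — blow-up, backward uniqueness Thm. 5.1, unique continuation Thm. 4.1),
`seregin_L3_blowup_mild` (Seregin 2012, Thm. 1.1 for mild `C([0,T); L³)` solutions, in the form of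
Lemarié-Rieusset 2016, Thm. 15.5) and `tao_quantitative_ess` (Tao 2021, Thm. 1.2). The ESS
conjunct is `ess_endpoint_of_local_holder hLH` (ESS §3: Thm. 1.3 from Thm. 1.4, with Lemma 2.2,
(3.2)–(3.4), Thm. 7.4, the energy equality and Thm. 1.2 all theorems of the tree); the Seregin
conjunct is `seregin_L3_blowup_of_ess` fed with Thm. 15.5, with ESS (3.5)–(3.6)
(`ess_sup_bound_of_local_holder hLH`) and with Leray's lower blow-up rate
(`leray_blowup_rate_top_holds`, Leray 1934, §20 (3.9)); the Tao conjunct is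
`tao_L3_blowup_rate_of_quantitative h12` (Tao 2021, §6: Thm. 1.4 from Thm. 1.2 and the
Prodi–Serrin–Ladyzhenskaya criterion, the local existence theorem being proved,
`tao2011_smooth_local_existence_holds`). Real proof (assembly); `CriticalNormBlowupNecessity_holds`
is this theorem applied to `ess_local_holder_holds`, `seregin_L3_blowup_mild_holds`,
`tao_quantitative_ess_holds` once they land. [cite: EscauriazaSereginSverak2003, Thms. 1.3–1.4, §3] [cite: Seregin2012CMP, Thm. 1.1] -/
theorem criticalNormBlowupNecessity_of_leaves₃ (hLH : ess_local_holder)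
    (h15 : seregin_L3_blowup_mild) (h12 : tao_quantitative_ess) : CriticalNormBlowupNecessity :=
  criticalNormBlowupNecessity_of (ess_endpoint_of_local_holder hLH)
    (seregin_L3_blowup_of_ess h15 (ess_sup_bound_of_local_holder hLH) leray_blowup_rate_top_holds)
    (tao_L3_blowup_rate_of_quantitative h12)

/-- The three leaves conjoined (dependency-tracker form). [cite: EscauriazaSereginSverak2003, Thms. 1.3–1.4] -/
theorem criticalNormBlowupNecessity_of_and₃
    (h : ess_local_holder ∧ seregin_L3_blowup_mild ∧ tao_quantitative_ess) :
    CriticalNormBlowupNecessity :=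
  criticalNormBlowupNecessity_of_leaves₃ h.1 h.2.1 h.2.2

/-! ### Below the three leaves: no points of concentration (ESS §3) and Seregin's core fact -/

/-- **The barrier from the current frontier** (2026-08-15): the statement (NC) that no point of
`Q̄(1/2)` is a point of `ε`-concentration of `|v|³ + |p|^{3/2}` for a pair `(v, p)` with ESS
(1.15)–(1.16) on `Q(1)` (for every `z₀ ∈ Q̄(1/2)` and `ε > 0` some scale `0 < r ≤ 1/2` has
`r⁻² ∫_{Q(z₀,r)} (|v|³ + |p|^{3/2}) < ε` — what the blow-up argument of ESS §3, (3.8)–(3.35),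
establishes from backward uniqueness, Thm. 5.1, and unique continuation, Thm. 4.1), stated
verbatim as the hypothesis `hno` of the accepted `ess_endpoint_of_noConcentration` and
`ess_local_holder_of_epsilonRegularity_of_noConcentration`, together with `seregin_L3_blowup_mild`
(Seregin 2012, Thm. 1.1 for mild `C_t L³` solutions = Lemarié-Rieusset 2016, Thm. 15.5) and
`tao_quantitative_ess` (Tao 2021, Thm. 1.2), implies `CriticalNormBlowupNecessity`. The ESS
conjunct is `ess_endpoint_of_noConcentration hno` (ESS Thm. 1.3 from (NC) through (3.5)–(3.6) in
the boundedness form of ε-regularity, Thm. 7.4, the energy equality and Thm. 1.2, all theorems of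
the tree — the Hölder form of Lemma 2.2 is not needed); the Seregin conjunct is
`seregin_L3_blowup_of_seregin_mild h15` (Lemarié-Rieusset 2016, Thm. 15.13, with
`mild_L3_smooth_holds`); the Tao conjunct is `tao_L3_blowup_rate_of_quantitative h12`. Real proof
(assembly). [cite: EscauriazaSereginSverak2003, Thms. 1.3–1.4, §3 (3.8)–(3.35)] [cite: Seregin2012CMP, Thm. 1.1] -/
theorem criticalNormBlowupNecessity_of_noConcentration
    (hno : ∀ (v : ℝ → EuclideanSpace ℝ (Fin 3) → EuclideanSpace ℝ (Fin 3))
      (p : ℝ → EuclideanSpace ℝ (Fin 3) → ℝ),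
      IsL3inftyLocalPair 1 1 ((0 : ℝ), (0 : EuclideanSpace ℝ (Fin 3))) v p →
      ∀ z ∈ closure (parabolicCylinder (1 / 2) ((0 : ℝ), (0 : EuclideanSpace ℝ (Fin 3)))),
        ∀ ε : ℝ, 0 < ε →
        ∃ r ∈ Set.Ioc (0 : ℝ) (1 / 2), ENNReal.ofReal ((r ^ 2)⁻¹) *
          ∫⁻ w in parabolicCylinder r z, (‖v w.1 w.2‖ₑ ^ 3 + ‖p w.1 w.2‖ₑ ^ (3 / 2 : ℝ)) <
            ENNReal.ofReal ε)
    (h15 : seregin_L3_blowup_mild) (h12 : tao_quantitative_ess) : CriticalNormBlowupNecessity :=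
  criticalNormBlowupNecessity_of (ess_endpoint_of_noConcentration hno)
    (seregin_L3_blowup_of_seregin_mild h15) (tao_L3_blowup_rate_of_quantitative h12)

/-- **The barrier from (NC), Seregin's core fact and Tao's Thm. 1.2**: as
`criticalNormBlowupNecessity_of_noConcentration`, with Thm. 15.5 obtained from the core fact
`seregin_regular_of_liminf_L3` (an `L³` bound along times `t_k ↑ T` makes every point `(T, x₀)`
regular; Lemarié-Rieusset 2016, proof of Thm. 15.5, pp. 570–573 = Seregin 2012, §§2–4) through the
accepted `seregin_L3_blowup_mild_of_liminf_L3` (Thm. 15.1 (C) being proved,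
`lemarieRieusset_singular_point_of_blowup_holds`). `CriticalNormBlowupNecessity_holds` is this
theorem applied to a proof of (NC), `seregin_regular_of_liminf_L3_holds` and
`tao_quantitative_ess_holds` once they land. Real proof (assembly).
[cite: EscauriazaSereginSverak2003, Thms. 1.3–1.4, §3] [cite: LemarieRieusset2016, Thm. 15.5 (proof, pp. 570–573)] -/
theorem criticalNormBlowupNecessity_of_noConcentration_of_liminf_L3
    (hno : ∀ (v : ℝ → EuclideanSpace ℝ (Fin 3) → EuclideanSpace ℝ (Fin 3))
      (p : ℝ → EuclideanSpace ℝ (Fin 3) → ℝ),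
      IsL3inftyLocalPair 1 1 ((0 : ℝ), (0 : EuclideanSpace ℝ (Fin 3))) v p →
      ∀ z ∈ closure (parabolicCylinder (1 / 2) ((0 : ℝ), (0 : EuclideanSpace ℝ (Fin 3)))),
        ∀ ε : ℝ, 0 < ε →
        ∃ r ∈ Set.Ioc (0 : ℝ) (1 / 2), ENNReal.ofReal ((r ^ 2)⁻¹) *
          ∫⁻ w in parabolicCylinder r z, (‖v w.1 w.2‖ₑ ^ 3 + ‖p w.1 w.2‖ₑ ^ (3 / 2 : ℝ)) <
            ENNReal.ofReal ε)
    (hS : seregin_regular_of_liminf_L3) (h12 : tao_quantitative_ess) :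
    CriticalNormBlowupNecessity :=
  criticalNormBlowupNecessity_of_noConcentration hno (seregin_L3_blowup_mild_of_liminf_L3 hS) h12

/-! ### Fact decomposition record (librarian `fact-decompose`, 2026-08-16): two leaves -/

/-- **Assembly of the split of `CriticalNormBlowupNecessity`** (budget-capped fact, human ruling
2026-08-16). Conjunct (i) `ess_endpoint` (ESS 2003, Thms. 1.3–1.4) is now a THEOREM of the tree
(`ess_endpoint_holds`, `NSEssEndpointHolds.lean`), conjunct (ii) `seregin_L3_blowup` follows from
Seregin's theorem for mild `C([0,T*); L³)` solutions alone (`seregin_L3_blowup_of_seregin_mild`,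
`MildL3SmoothHolds.lean`: Lemarié-Rieusset 2016, Thm. 15.13 from Thm. 15.5 with Thm. 15.1 (A)
discharged), and conjunct (iii) `tao_L3_blowup_rate` from Tao's Thm. 1.2 alone
(`tao_L3_blowup_rate_of_quantitative`). So the barrier rests on exactly TWO named leaves, the
children of the split: `seregin_L3_blowup_mild` (Seregin 2012, Thm. 1.1 in Lemarié-Rieusset's mild
form, Thm. 15.5) and `tao_quantitative_ess` (Tao 2021, Thm. 1.2); `CriticalNormBlowupNecessity_holds`
is this theorem applied to their discharges. (Improves `criticalNormBlowupNecessity_of_leaves₃`,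
whose third leaf `ess_local_holder` is no longer needed.)
[cite: EscauriazaSereginSverak2003, Thms. 1.3–1.4] [cite: Seregin2012CMP, Thm. 1.1]
[cite: LemarieRieusset2016, Thm. 15.5 and Thm. 15.13] [cite: Tao2021QuantitativeNS, Thm. 1.4 from Thm. 1.2 (§6)] -/
theorem CriticalNormBlowupNecessity_holds_of :
    seregin_L3_blowup_mild → tao_quantitative_ess → CriticalNormBlowupNecessity :=
  fun h15 h12 => criticalNormBlowupNecessity_of ess_endpoint_holds
    (seregin_L3_blowup_of_seregin_mild h15) (tao_L3_blowup_rate_of_quantitative h12)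

end Literature.Barriers.NavierStokesRegularity

end
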